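import Literature.MathematicalPhysics.QuantumFieldTheory.Balaban1983to89.B9Thm313WholeDelta2LettersAtPinsPrint
import Literature.MathematicalPhysics.QuantumFieldTheory.Balaban1983to89.B9SmoothHolderClassState

/-!
# `Balaban1983to89.B9Thm313WholeDelta2LettersAtStatePrint` — THE HONEST `hta₂` AND `Letters3131H.tb₂H` OF ROWS 20–21 AT THE REGULAR STATE CLASS
# `𝔖₂ = (Lʲη)⁻¹·bHZKPG g w₂` (the (P1′) class carried to dimension 2), FROM THE CERTIFICATE'S OWN DISPLAYS: `h44G` ((3.44) for G′), `h43Gp` ((3.43) for G′∇\*_U),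
# `hD2sup` ((3.137)), `h31`, `h49`, and the (P1′) class axiom — LOCATED-U8's cure at the letter level, no new display

T. Bałaban, *Propagators for lattice gauge theories in a background field*, Commun. Math. Phys. **99** (1985) 389–434 [`Balaban1985BackgroundPropagators`,
"B9"]; [4] = T. Bałaban, *Propagators and renormalization transformations for lattice gauge theories. II*, Commun. Math. Phys. **96** (1984) 223–250
[`Balaban1984PropagatorsII`].  statement-level skeleton of published theorems with citation tags; proofs where landed; nothing here is a claim about the
Yang–Mills mass gap.  Sequel of `B9Thm313WholeDelta2LettersAtPinsPrint` §4 (the letters from ANY regular source `b₁`) and `B9SmoothHolderClassState` (the readings of 𝔖₂).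

THE PRINT.  (3.44) p. 398: *"|(∇_UG′(U)∇\*_Uλ)(x)| ≦ B₀′(ε)e^{−δ₀d(y,y′)}(‖λ‖^{ξ′}_ε + |λ|) … (B₀′(ε) → ∞ if ε → 0)"*; (3.135) p. 422; (3.137) p. 423; p. 423: *"derivatives … have to be applied either to
the operator on the right, or on the left"*; p. 422: *"convergence … in all norms appearing on the left-hand sides of the inequalities (3.42)–(3.47)"*.

THE POINT (dag-n06-l LOCATED-U8, `DELTA2-LETTERS-MEMO.md` §5).  The certificate displays `hta₂ : HasMaj (cNorm blk 2) (cNorm blk 0) (Ta2LcoK … (GpPhysY) Δ2 U) (t·θ·e^{−δd})` — T_a₂ =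
Δ⁽²⁾(1 − D_UG′RD\*_U) on the RAW class, beyond print.  With the SOURCE replaced by the regular state class 𝔖₂(U) := `weightNorm (bHZKPG (U(Γ)) w₂) (rwt (−1))` of the (3.138) step,
the SAME letter is a theorem of the certificate's existing displays: the sup channel of 𝔖₂ (class axiom, g24 `hasMaj_id_bHZKPG_cNorm`) and its (3.44) channel — the display
`h44G : HasMaj (bHZKP (U(Γ)) s) (cNorm blk 1) (Dv ∘ G′ ∘ Dvstar)` read out of 𝔖₂ (`B9SmoothHolderClassState.hasMaj_state_of_exponent`).  THIS FILE:
* §1 ★★★ `ta2S_pins_print_of_h44G` — `HasMaj 𝔖₂ (cNorm (blkBK bI) 0) (Ta2LcoK … (GpPhysY …) Δ2 U) (K_T·e^{−δ_T d})` from `hD2sup h31 h49 h44G` + the (P1′) axiom binders (`hlev hbI0 hN hcf`),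
  member-uniform `K_T` (explicit in θ₂ = θ₂′·Mα₀, B₄₄, (w₂ s)⁻¹, c_R⁻¹, B₀, C_P, c, L), for 0 ≦ δ_T, δ_T + 3σ + 3αδ_F ≦ r ≦ min(δ₀, δ_P, δ₂, δ₄₄ − αδ_F);
* §2 ★★★ `tb₂HS_pins_print_of_h43` — `HasMaj 𝔖₂ (bHZPG (taxiS U) w₁₃) (Tb2LcoKH … (GpPhysY …) Δ2 U) (K_H·e^{−ρd})` from the same + ONE (3.43) member `h43` of G′∇\*_U (dag-n06-l g25 engine):
  the `tb₂H` field of `Letters3131H` at the pins (P1′) → (P2′) with the source 𝔖₂.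
* §3 ★★ `hasMaj_state_of_raw_two` — ANY letter on the raw class `cNorm (blkBK bI) 2` (today's derived `hta`, g25's `tbH_pins_print_of_h43`) holds on 𝔖₂: the `ta ∕ tbH` fields of `LettersS3131`.
WHAT THIS GIVES THE CERTIFICATE (dag-n06-d): once the step schema over 𝔖₂ replaces `Step`∕`hK` (dag-n06-l R4b–c), the displays `hta₂` and the T_b₂ half of `hL3131H` are these two
theorems — inputs `h44G h43Gp hD2sup h31 h49` + pins, all already displayed.
HONEST SCOPE.  Bookkeeping over landed objects; Theorem 3.1∕3.3 ((3.42)–(3.44)), (3.49), (3.137), the class axiom and the member facts enter as HYPOTHESES of printed species; constants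
ours, explicit, not optimised; no pin or certificate is edited; COUNT-NEUTRAL; N06 NOT discharged; one finite torus at a time — nothing continuum ∕ OS ∕ mass gap.  Cell `pub-ymgap`
(HUMAN RULING D-0062), Track A node N06 [B9], bundle F7 rows 20–21, seat `pub-ymgap-dag-n06-l` (g26), 2026-08-29.  NEW file; nothing landed is modified.
-/

noncomputable section

namespace Literature.MathematicalPhysics.QuantumFieldTheory.Balaban1983to89.B9Thm313WholeDelta2LettersAtStatePrint

open B6Geom246MultiLevelTorus (geomT)
open B6GlobalChartV1 (PV blkV1)
open B6Ineq2142KLevelV1 (β lvl)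
open B6KLevelCensusIndexV1 (KIdx)
open B6Prop22KLevelTorusCensusEta (nKT)
open B9GeoNormsKLevelV1 (geo9K)
open B9Thm34Ext (toB6)
open B9Thm39ReadingCoords (cR39)
open B9SectDSup (weightNorm)
open B9Thm312Whole (GeoOK cNorm)
open B9Thm312WholeClasses (cNormR rwt rwt_nonneg)
open B9RWSums343to347Whole (Facts347)
open B6RandomWalk (HasMajorant)
open B11SectG (BlockNorm HasMaj RowSum)
open B9CoReadingCoords (XBK blkBK)
open B9CoReadingCoordsS (XSK sIK blkSK GcoS)
open B9MultiscaleSmoothPartitionY (NearY)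
open B9GradViaDivLettersTransported (taxiS)
open B9SmoothHolderClassP (bHZKP bHZPG bHZKPG)
open B9SmoothHolderClassPProducers (CTel)
open B9SmoothHolderClassState (hasMaj_id_state hasMaj_state_of_exponent hasMaj_of_src_reading)
open B9PerturbationMajorantAlgebra (Thm31GpMaj Proj349Maj hasMaj_weaken rpow_abs_eq_pow)
open B9PerturbationMajorantsAtLetters (PcoK)
open B9PerturbationSplitAtLetters (Ta2LcoK Tb2LcoKH)
open B9PerturbationL2Delta2 (D2coK)
open B9Thm313WholeDelta2LettersAtPinsPrint (ta2_pins_of_h44 tb₂H_pins_of_h43_of_src)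
open Node00 (SiteY FBondY IBondY CfgY toKT SiteParY BondOpY GpY GpPhysY)
open Node00.OpsYSectDCoords (DvcoKH DvscoKH)
open T4RelativeLadder (UnitaryLike)

variable {𝔸 : Type} [NormedRing 𝔸] [NormedAlgebra ℂ 𝔸] [CompleteSpace 𝔸] [FiniteDimensional ℝ 𝔸]
variable {κ : Type} [Fintype κ]
variable {d ℓ : ℕ} {hd : 1 ≤ d + 1} {hL : Odd (ℓ + 1) ∧ 1 < ℓ + 1} {b₀ b₁ : ℝ} (i : KIdx d ℓ hd hL b₀ b₁)
  (b : Module.Basis κ ℝ 𝔸) (B : B9.Backgrounds) (cfg : B.Cfg → CfgY 𝔸 i) (parS : SiteParY 𝔸 i) (Δ2 : BondOpY 𝔸 i)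
variable [Fintype (geo9K i).Site] {R₀ : ℝ} {H₀ : Prop} {bI : FBondY i → IBondY i} {dF : ℕ} {δF α L₀ σ c : ℝ}
variable (gB : FBondY i → FBondY i → 𝔸ˣ) (w₂ : ℝ → ℝ) (hw₂0 : ∀ s, 0 ≤ w₂ s) (hw₂1 : ∀ s, w₂ s ≤ 1)

/-! ## §1 ★★★ T_a₂ at the regular state class from `h44G` -/

/-- ★★★ **THE HONEST `hta₂` AT THE STATE CLASS 𝔖₂ = `(Lʲη)⁻¹·bHZKPG g_B w₂`** (the (P1′) class with its transporter table `g_B`, carried to dimension 2): from the certificate's `h44G`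
((3.44) for G′: `Dv ∘ G′ ∘ Dvstar` OUT OF `bHZKP g_B s` INTO `cNorm (blkBK bI) 1`, at one exponent `0 < s < 1` with `0 < w₂ s`), the (P1′) class-axiom binders `hlev hbI0 hN hcf`, and `hD2sup h31 h49`:
`HasMaj 𝔖₂ (cNorm (blkBK bI) 0) (Ta2LcoK … (GpPhysY …) Δ2 U) (K_T·e^{−δ_T d})`.  No raw-class sandwich: the (3.44) member of 𝔖₂ is print's.
[cite: Balaban1985BackgroundPropagators, (3.44) p.398, (3.135) p.422, (3.137) p.423, (3.42) p.397, (3.49) p.399, p.398 (remark after (3.47)), p.423; Balaban1984PropagatorsII, (2.51)–(2.54), (2.60)–(2.61) pp.232–234] -/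
theorem ta2S_pins_print_of_h44G (hG : GeoOK (geo9K i)) (hF : Facts347 (geo9K i) R₀ H₀ dF δF α L₀) (hrow : RowSum (toB6 (geo9K i) R₀ H₀) σ c) (hc0 : 0 < cR39 b)
    {s : ℝ} (hs0 : 0 < s) (hs1 : s < 1) (hws : 0 < w₂ s)
    (hlev : ∀ f : FBondY i, lvl i.hN i.D i.hk (bI f) = (blkV1 i.hN i.D f).1.1) (hbI0 : ∀ f : FBondY i, bI f = bI ⟨f.src, 0⟩)
    {rN : ℝ} (hN : ∀ (y : IBondY i) (z : SiteY i), NearY i y z → (geo9K i).dist y (sIK i bI z) ≤ rN) (hcf : |i.cf| = (nKT (toKT i) : ℝ))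
    {U₁ : B.Cfg} {B₀ δ₀ CP δP θ₂ δ₂ B44 δ44 r δT : ℝ}
    (h31 : Thm31GpMaj (g := geo9K i) (blkSK (κ := κ) i (sIK i bI)) (blkBK (κ := κ) i bI) (GcoS i b B cfg (GpY i parS) U₁) (DvcoKH i b B cfg U₁) (DvscoKH i b B cfg U₁) R₀ H₀ B₀ δ₀)
    (h49 : Proj349Maj (g := geo9K i) (blkSK (κ := κ) i (sIK i bI)) (blkBK (κ := κ) i bI) (PcoK i b B cfg parS (GpY i parS) U₁) (DvcoKH i b B cfg U₁) (DvscoKH i b B cfg U₁) R₀ H₀ CP δP)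
    (hD2 : HasMajorant (g := toB6 (geo9K i) R₀ H₀) (blkBK (κ := κ) i bI) (D2coK i b B cfg Δ2 U₁)
      (fun (a a' : (geo9K i).Site) => θ₂ * ((geo9K i).len a ^ 2)⁻¹ * Real.exp (-(δ₂ * (geo9K i).dist a a'))))
    (h44G : HasMaj (bHZKP (κ := κ) i b gB (R := R₀) (H := H₀) (s := s) hs0.le hs1.le) (cNorm R₀ H₀ (blkBK i bI) hG.lenle 1)
      (DvcoKH i b B cfg U₁ ∘ₗ GcoS i b B cfg (GpY i parS) U₁ ∘ₗ DvscoKH i b B cfg U₁) (fun a a' => B44 * Real.exp (-(δ44 * (geo9K i).dist a a'))))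
    (hB₀ : 0 ≤ B₀) (hCP : 0 ≤ CP) (hθ₂ : 0 ≤ θ₂) (hB44 : 0 ≤ B44) (hc : 0 ≤ c) (hσ : 0 ≤ σ) (hτ : 0 ≤ α * δF) (hr : 0 ≤ r)
    (hr₀ : r ≤ δ₀) (hrP : r ≤ δP) (hr₂ : r ≤ δ₂) (hr44 : r + α * δF ≤ δ44) (hδT₀ : 0 ≤ δT) (hδT : δT + 3 * σ + 3 * (α * δF) ≤ r) :
    HasMaj (weightNorm (bHZKPG (κ := κ) i b gB (R := R₀) (H := H₀) w₂ hw₂0 hw₂1) (rwt (geo9K i) (-1)) (rwt_nonneg hG.lenle (-1)))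
      (cNorm R₀ H₀ (blkBK i bI) hG.lenle 0) (Ta2LcoK i b B cfg parS (GpPhysY i parS) Δ2 U₁)
      (fun a a' => θ₂ * (geo9K i).L ^ 2 *
          ((w₂ s)⁻¹ * ((((ℓ + 1 : ℕ) : ℝ)) * Real.exp ((r + α * δF) * rN)) * (geo9K i).L +
            (cR39 b)⁻¹ * ((w₂ s)⁻¹ * B44 * (geo9K i).L) +
            (cR39 b)⁻¹ * (B₀ * (geo9K i).L * (CP * (geo9K i).L ^ 2) * c * ((w₂ s)⁻¹ * ((((ℓ + 1 : ℕ) : ℝ)) * Real.exp ((r + α * δF) * rN)) * (geo9K i).L) * c)) * c *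
        Real.exp (-(δT * (geo9K i).dist a a'))) := by
  have hL0 : 0 ≤ (geo9K i).L := le_trans zero_le_one hF.one_le_L
  have hws' : 0 ≤ (w₂ s)⁻¹ := inv_nonneg.2 hws.le
  -- the sup reading of 𝔖₂ at rate (r + αδ_F) − αδ_F = r
  have hsrc₀ := hasMaj_id_state i b gB (R := R₀) (H := H₀) w₂ hw₂0 hw₂1 hG hF hs0 hs1 hws hlev hbI0 (δ := r + α * δF) (by linarith) hN hcf
  have hCs : 0 ≤ (w₂ s)⁻¹ * ((((ℓ + 1 : ℕ) : ℝ)) * Real.exp ((r + α * δF) * rN)) * (geo9K i).L := by positivity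
  have hsrc := hasMaj_weaken hG hCs le_rfl (show r ≤ r + α * δF - α * δF by linarith) hsrc₀
  -- the (3.44) reading of 𝔖₂ from h44G, rate δ₄₄ − αδ_F ≥ r
  have h44₀ := hasMaj_state_of_exponent i b gB (R := R₀) (H := H₀) w₂ hw₂0 hw₂1 hG hF hs0 hs1 hws hB44 h44G
  have hC44 : 0 ≤ (w₂ s)⁻¹ * B44 * (geo9K i).L := by positivity
  have h44 := hasMaj_weaken hG hC44 le_rfl (show r ≤ δ44 - α * δF by linarith) h44₀
  exact ta2_pins_of_h44 i b B cfg parS Δ2 hG hF hrow hc0 h31 h49 hD2 hsrc h44 hB₀ hCP hθ₂ hCs hC44 hc hσ hτ hr₀ hrP hr₂ hδT₀ hδT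

/-! ## §2 ★★★ T_b₂ INTO the (P2′) class from the regular state class and ONE (3.43) member -/

variable (w : ℝ → ℝ) (hw0 : ∀ s, 0 ≤ w s) (hw1 : ∀ s, w s ≤ 1)

/-- ★★★ **THE HONEST `Letters3131H.tb₂H` AT THE STATE CLASS**: `HasMaj 𝔖₂ (bHZPG (taxiS U) w) (Tb2LcoKH … (GpPhysY …) Δ2 U) (K_H·e^{−ρd})` — (P1′)-state → (P2′) class — from `h43`
(ONE (3.43) member of G′∇\*_U INTO the (P2′) class), `h44G` ((3.44) for G′ out of the (P1′) class), `hD2sup h31 h49`, the (P1′) axiom binders and the telescope's side binders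
(`hβ1 hlev hcf hU`); ρ + 3σ + 3αδ_F ≤ r ≤ min(δ₀, δ_P, δ₂, δ₄₄ − αδ_F), ρ + σ ≤ δ₄₃. [cite: Balaban1985BackgroundPropagators, (3.135) p.422 + (3.137) p.423 + (3.43)–(3.44) p.398 + (3.42) p.397 + (3.49) p.399 + p.421 + p.423; Balaban1984PropagatorsII, (2.51)–(2.54), (2.60)–(2.61) pp.232–234] -/
theorem tb₂HS_pins_print_of_h43 (hG : GeoOK (geo9K i)) (hF : Facts347 (geo9K i) R₀ H₀ dF δF α L₀) (hrow : RowSum (toB6 (geo9K i) R₀ H₀) σ c) (hc0 : 0 < cR39 b)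
    {s : ℝ} (hs0 : 0 < s) (hs1 : s < 1) (hws : 0 < w₂ s)
    (hβ1 : ∀ f : FBondY i, (geomT i.D).dist (β i.hN i.D i.hk (bI f)) (blkV1 i.hN i.D f) ≤ 1)
    (hlev : ∀ f : FBondY i, lvl i.hN i.D i.hk (bI f) = (blkV1 i.hN i.D f).1.1) (hbI0 : ∀ f : FBondY i, bI f = bI ⟨f.src, 0⟩)
    {rN : ℝ} (hN : ∀ (y : IBondY i) (z : SiteY i), NearY i y z → (geo9K i).dist y (sIK i bI z) ≤ rN) (hcf : |i.cf| = (nKT (toKT i) : ℝ))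
    {U₁ : B.Cfg} (hU : ∀ ν x, UnitaryLike (cfg U₁ ν x)) {B₀ δ₀ CP δP θ₂ δ₂ B44 δ44 B43 δ43 r ρ : ℝ}
    (h31 : Thm31GpMaj (g := geo9K i) (blkSK (κ := κ) i (sIK i bI)) (blkBK (κ := κ) i bI) (GcoS i b B cfg (GpY i parS) U₁) (DvcoKH i b B cfg U₁) (DvscoKH i b B cfg U₁) R₀ H₀ B₀ δ₀)
    (h49 : Proj349Maj (g := geo9K i) (blkSK (κ := κ) i (sIK i bI)) (blkBK (κ := κ) i bI) (PcoK i b B cfg parS (GpY i parS) U₁) (DvcoKH i b B cfg U₁) (DvscoKH i b B cfg U₁) R₀ H₀ CP δP)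
    (hD2 : HasMajorant (g := toB6 (geo9K i) R₀ H₀) (blkBK (κ := κ) i bI) (D2coK i b B cfg Δ2 U₁)
      (fun (a a' : (geo9K i).Site) => θ₂ * ((geo9K i).len a ^ 2)⁻¹ * Real.exp (-(δ₂ * (geo9K i).dist a a'))))
    (h44G : HasMaj (bHZKP (κ := κ) i b gB (R := R₀) (H := H₀) (s := s) hs0.le hs1.le) (cNorm R₀ H₀ (blkBK i bI) hG.lenle 1)
      (DvcoKH i b B cfg U₁ ∘ₗ GcoS i b B cfg (GpY i parS) U₁ ∘ₗ DvscoKH i b B cfg U₁) (fun a a' => B44 * Real.exp (-(δ44 * (geo9K i).dist a a'))))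
    (h43 : HasMaj (cNorm R₀ H₀ (blkBK i bI) hG.lenle 0) (bHZPG (κ := κ) i b (taxiS i B cfg U₁) (R := R₀) (H := H₀) w hw0 hw1)
      (GcoS i b B cfg (GpY i parS) U₁ ∘ₗ DvscoKH i b B cfg U₁) (fun a a' => B43 * Real.exp (-(δ43 * (geo9K i).dist a a'))))
    (hB₀ : 0 ≤ B₀) (hCP : 0 ≤ CP) (hθ₂ : 0 ≤ θ₂) (hB44 : 0 ≤ B44) (hB43 : 0 ≤ B43) (hc : 0 ≤ c) (hσ : 0 ≤ σ) (hτ : 0 ≤ α * δF) (hr : 0 ≤ r)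
    (hr₀ : r ≤ δ₀) (hrP : r ≤ δP) (hr₂ : r ≤ δ₂) (hr44 : r + α * δF ≤ δ44) (hρ : 0 ≤ ρ) (hbud : ρ + 3 * σ + 3 * (α * δF) ≤ r) (hbud43 : ρ + σ ≤ δ43) :
    HasMaj (weightNorm (bHZKPG (κ := κ) i b gB (R := R₀) (H := H₀) w₂ hw₂0 hw₂1) (rwt (geo9K i) (-1)) (rwt_nonneg hG.lenle (-1)))
      (bHZPG (κ := κ) i b (taxiS i B cfg U₁) (R := R₀) (H := H₀) w hw0 hw1) (Tb2LcoKH i b B cfg parS (GpPhysY i parS) Δ2 U₁)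
      (fun a a' => (B43 * ((cR39 b)⁻¹ *
              (θ₂ * (geo9K i).L ^ 2 * (((w₂ s)⁻¹ * ((((ℓ + 1 : ℕ) : ℝ)) * Real.exp ((r + α * δF) * rN)) * (geo9K i).L) +
                (cR39 b)⁻¹ * ((w₂ s)⁻¹ * B44 * (geo9K i).L) +
                (cR39 b)⁻¹ * (B₀ * (geo9K i).L * (CP * (geo9K i).L ^ 2) * c * ((w₂ s)⁻¹ * ((((ℓ + 1 : ℕ) : ℝ)) * Real.exp ((r + α * δF) * rN)) * (geo9K i).L) * c)) * c)) * c +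
            CTel d ℓ b ρ
              (CP * (geo9K i).L * (B₀ * ((cR39 b)⁻¹ *
                (θ₂ * (geo9K i).L ^ 2 * (((w₂ s)⁻¹ * ((((ℓ + 1 : ℕ) : ℝ)) * Real.exp ((r + α * δF) * rN)) * (geo9K i).L) +
                  (cR39 b)⁻¹ * ((w₂ s)⁻¹ * B44 * (geo9K i).L) +
                  (cR39 b)⁻¹ * (B₀ * (geo9K i).L * (CP * (geo9K i).L ^ 2) * c * ((w₂ s)⁻¹ * ((((ℓ + 1 : ℕ) : ℝ)) * Real.exp ((r + α * δF) * rN)) * (geo9K i).L) * c)) * c)) * c) * c)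
              (CP * (geo9K i).L * (B₀ * ((cR39 b)⁻¹ *
                (θ₂ * (geo9K i).L ^ 2 * (((w₂ s)⁻¹ * ((((ℓ + 1 : ℕ) : ℝ)) * Real.exp ((r + α * δF) * rN)) * (geo9K i).L) +
                  (cR39 b)⁻¹ * ((w₂ s)⁻¹ * B44 * (geo9K i).L) +
                  (cR39 b)⁻¹ * (B₀ * (geo9K i).L * (CP * (geo9K i).L ^ 2) * c * ((w₂ s)⁻¹ * ((((ℓ + 1 : ℕ) : ℝ)) * Real.exp ((r + α * δF) * rN)) * (geo9K i).L) * c)) * c)) * c) * c)) *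
        Real.exp (-(ρ * (geo9K i).dist a a'))) := by
  have hL0 : 0 ≤ (geo9K i).L := le_trans zero_le_one hF.one_le_L
  have hws' : 0 ≤ (w₂ s)⁻¹ := inv_nonneg.2 hws.le
  have hsrc₀ := hasMaj_id_state i b gB (R := R₀) (H := H₀) w₂ hw₂0 hw₂1 hG hF hs0 hs1 hws hlev hbI0 (δ := r + α * δF) (by linarith) hN hcf
  have hCs : 0 ≤ (w₂ s)⁻¹ * ((((ℓ + 1 : ℕ) : ℝ)) * Real.exp ((r + α * δF) * rN)) * (geo9K i).L := by positivity
  have hsrc := hasMaj_weaken hG hCs le_rfl (show r ≤ r + α * δF - α * δF by linarith) hsrc₀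
  have h44₀ := hasMaj_state_of_exponent i b gB (R := R₀) (H := H₀) w₂ hw₂0 hw₂1 hG hF hs0 hs1 hws hB44 h44G
  have hC44 : 0 ≤ (w₂ s)⁻¹ * B44 * (geo9K i).L := by positivity
  have h44 := hasMaj_weaken hG hC44 le_rfl (show r ≤ δ44 - α * δF by linarith) h44₀
  exact tb₂H_pins_of_h43_of_src i b B cfg parS Δ2 w hw0 hw1 hG hF hrow hc0 hβ1 hlev hcf hU h31 h49 h43 hD2 hsrc h44 hB₀ hCP hB43 hθ₂ hCs hC44 hc hσ hτ
    hr₀ hrP hr₂ hρ hbud hbud43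

/-! ## §3 Every raw-class letter of rows 20–21 holds on the state class (the `ta ∕ tbH` fields of `LettersS3131` at the pins) -/

omit [CompleteSpace 𝔸] [FiniteDimensional ℝ 𝔸] in
/-- ★★ **A LETTER ON THE RAW CLASS `cNorm (blkBK bI) 2` HOLDS ON THE STATE CLASS 𝔖₂** (any target `b₂`): today's derived `hta : T_a : cNorm 2 → cNorm 0` and `tbH : T_b : cNorm 2 → bH13`
(dag-n06-l g14 `hta_of_letters_phys`, g25 `tbH_pins_print_of_h43`), or any other raw-source letter with `t·e^{−δ_T d}`, precomposed with 𝔖₂'s sup reading: `T : 𝔖₂ → b₂` with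
`t·C_s·c·e^{−ρd}`, `C_s = (w₂ s)⁻¹·L·e^{(ρ+αδ_F)r_N}·L`, ρ + σ ≤ δ_T — the `ta ∕ tbH` fields of `B9Thm312WholeStepRegular.LettersS3131` at 𝔖₂ (the `ta₂ ∕ tb₂H` fields are §1–§2).
[cite: Balaban1985BackgroundPropagators, (3.131) p.422 + (3.41)–(3.42) p.397 + p.398 (remark after (3.47)); Balaban1984PropagatorsII, (2.52)–(2.56) pp.232–233, (2.60)–(2.61) p.234] -/
theorem hasMaj_state_of_raw_two (hG : GeoOK (geo9K i)) (hF : Facts347 (geo9K i) R₀ H₀ dF δF α L₀) (hrow : RowSum (toB6 (geo9K i) R₀ H₀) σ c)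
    {s : ℝ} (hs0 : 0 < s) (hs1 : s < 1) (hws : 0 < w₂ s)
    (hlev : ∀ f : FBondY i, lvl i.hN i.D i.hk (bI f) = (blkV1 i.hN i.D f).1.1) (hbI0 : ∀ f : FBondY i, bI f = bI ⟨f.src, 0⟩)
    {rN : ℝ} (hN : ∀ (y : IBondY i) (z : SiteY i), NearY i y z → (geo9K i).dist y (sIK i bI z) ≤ rN) (hcf : |i.cf| = (nKT (toKT i) : ℝ))
    {F₂ : Type} [AddCommGroup F₂] [Module ℝ F₂] {b₂ : BlockNorm (toB6 (geo9K i) R₀ H₀) F₂} {T : (XBK κ i → ℝ) →ₗ[ℝ] F₂} {t δT ρ : ℝ}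
    (ht : 0 ≤ t) (hρ : 0 ≤ ρ) (hρT : ρ + σ ≤ δT) (hτ : 0 ≤ α * δF)
    (hT : HasMaj (cNorm R₀ H₀ (blkBK i bI) hG.lenle 2) b₂ T (fun a a' => t * Real.exp (-(δT * (geo9K i).dist a a')))) :
    HasMaj (weightNorm (bHZKPG (κ := κ) i b gB (R := R₀) (H := H₀) w₂ hw₂0 hw₂1) (rwt (geo9K i) (-1)) (rwt_nonneg hG.lenle (-1))) b₂ T
      (fun a a' => t * ((w₂ s)⁻¹ * ((((ℓ + 1 : ℕ) : ℝ)) * Real.exp ((ρ + α * δF) * rN)) * (geo9K i).L) * c * Real.exp (-(ρ * (geo9K i).dist a a'))) := by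
  have hws' : 0 ≤ (w₂ s)⁻¹ := inv_nonneg.2 hws.le
  have hL0 : 0 ≤ (geo9K i).L := le_trans zero_le_one hF.one_le_L
  have hsrc₀ := hasMaj_id_state i b gB (R := R₀) (H := H₀) w₂ hw₂0 hw₂1 hG hF hs0 hs1 hws hlev hbI0 (δ := ρ + α * δF) (by linarith) hN hcf
  have hCs : 0 ≤ (w₂ s)⁻¹ * ((((ℓ + 1 : ℕ) : ℝ)) * Real.exp ((ρ + α * δF) * rN)) * (geo9K i).L := by positivity
  have hsrc := hasMaj_weaken hG hCs le_rfl (show ρ ≤ ρ + α * δF - α * δF by linarith) hsrc₀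
  rw [show (-2 : ℝ) = -((2 : ℕ) : ℝ) by norm_num] at hsrc
  exact hasMaj_of_src_reading hG hrow ht hCs hρ le_rfl hρT hT hsrc

end Literature.MathematicalPhysics.QuantumFieldTheory.Balaban1983to89.B9Thm313WholeDelta2LettersAtStatePrint

end
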